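/- Copyright: the b2b-balaban cell (near-miss cell 7), T⁴-continuum fan-out; row NE7b CRUX team (2), seat
t4-ne7b-formalise-leaf-03 (gen 28) — custodian's D-50-2′ «THE WEIGHTED PLUG CHAIN», part 2 of the chain: the WEIGHT-GENERIC
siblings of the lineage's own `HistoryRealiseCellsRunSupplyWTVS` §3∕§4 and `HistoryRealiseCellsRunSupplyKeysWTVS` §2 (gen 26),
the volume ledger a PLUG display, the class weight a letter; plus the weight monotonicity of the key family's `LIVEOf`.
Released under the licence of the surrounding project. -/
import Summits.QuantumFields.BalabanUV.T4Continuum.Support.B16HistoryWeightPlugW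
import Summits.QuantumFields.BalabanUV.T4Continuum.Support.HistoryRealiseCellsRunSupplyKeysWTVS

/-!
# D-50-2′ part 2 — THE WITNESS FIELDS `upM` ∕ `priceM` OF THE (α) ASSEMBLY AT ANY CLASS WEIGHT `w`, THE VOLUME LEDGER A PLUG
# (re-open object (α) of row NE7b; custodian lineage `t4-ne7b-formalise-leaf-03` gen 28, on the OWNER's R-OWNER-51-1 (5)
# commission «D-50-2»; located point F-ne7bleaf03g28-1)

Summits-side support leaf of the T⁴-continuum cell (rung (B)+1 on a FINITE torus only; NOT infinite volume, NOT the
mass gap, NOT the Clay statement; NOT a proof of the spine estimate NE7b — the cell's OWN estimate, NOT PRINTED, NOT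
PROVED).  [folklore] by-name copies of the lineage's `weight_le_deadOf_mul_mul_nupOf` ∕ `upM_of_reading` (part 2,
p274846) and `upM_of_reading'` ∕ `priceM_of_reading` (keys sibling, p276173) in which the M5-2c display block
`hLu0 hj1 hLu hsmall huΦ huE₂ huE₃` is REPLACED by the per-live-component PLUG display (part 1
`B16HistoryWeightPlugW.weight_le_live_mul_dead_of_plug`) and the literal `2 ^ (d + 3)` by a weight letter; plus
`LIVEOf_mono_weight`.  No `def`, no structure, no `[cite:]` tag, nothing printed asserted, no `Prop` fact, zero `sorry`.

WHY (F-ne7bleaf03g28-1).  The (α) record's volume fields reach the witness's `upM` only through these lemmas; with the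
weight a letter and the ledger a display, the SAME four theorems serve M5-2c (`w = 2^{d+3}`), M5-2d (`cvol`) and M5-2e
(`cvol82`) — the instance is chosen where the record is embedded (part 1 §3 `plug_of_flat` ∕ `plug_of_shrunk` ∕ (E5)).

WHAT.  §1 **`weight_le_deadOf_mul_mul_nupOf_of_plug`** (one term; part 2 §3's binders with the seven displays and the four
banking side conditions replaced by `(w) (hplug)` on the term's run, `hFcM` at weight `w`).  §2 per cutoff `K ≥ K₀`,
`|t| ≤ l₀`: **`upM_of_reading_of_plug`** (abstract `FcM`, `hplug` ∕ `hFcM` quantified over `termSet I K`),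
**`upM_of_reading'_of_plug`** (`FcM K := LIVEOf C K (ℛ.R K) (fun n => w * log (Φf.Λ K n)) (sharpT sB sR)` — `hFcM` discharged
by the weight-generic `live_le_LIVEOf`; the members' well-formedness keeps `4 ≤ L`, drop control, `R ≥ 1`, `13 ≤ n₁`),
**`priceM_of_reading_w`** (`priceM_of_reading` at a weight FUNCTION `u` — its engine `priceM_of_keys_of_charge` was always
generic).  §3 **`LIVEOf_mono_weight`**: `u ≤ u′` pointwise ⇒ `LIVEOf C K R u σ k ≤ LIVEOf C K R u′ σ k` (so a run-B display
`upB` booked at `2^{d+3}` serves every heavier weight, e.g. `cvol82 ≥ 2^{d+3}` by `two_pow_le_cvol82`).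

HONEST SCOPE.  Plumbing over OUR carriers; every display stays a HYPOTHESIS of the same R∕S class as in the twinned
modules (`HistRead`, pass-V process conditions, `FactorRead`, `W`, the rounding room, (2.9)); the plug display is
DISCHARGED where the record is embedded, never asserted.  NE7b NOT PRINTED ∕ NOT PROVED; spine 0∕9.  HONEST DEPENDENCY
(cell): continuum YM on T⁴ ⇐ BetaPertH ∧ nine spine estimates (0/9 proved); BetaPertH ⇐ (D1) ∧ (D4) ∧ CAP+tail; G-an2-4
gates asym, D1 and NE2/3/4.  This file changes none of it.
-/

open Finset MeasureTheory
open Literature.MathematicalPhysics.QuantumFieldTheory.Balaban1983to89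
open Literature.MathematicalPhysics.QuantumFieldTheory.Balaban1983to89.B13ScaleTransfer
open Literature.MathematicalPhysics.QuantumFieldTheory.Balaban1983to89.B16SProfile
open T4PersistenceDictionary T4PrintedShapeBanking T4TaggedShapeBanking T4BankedInduction T4PartnerMultiplicity
open T4LiveClassFibration
open Summit.QuantumFields.BalabanUV.T4Continuum.HistoryAdmissible
open Summit.QuantumFields.BalabanUV.T4Continuum.HistoryGen
open Summit.QuantumFields.BalabanUV.T4Continuum.HistoryGenealogyExtraction
open Summit.QuantumFields.BalabanUV.T4Continuum.HistoryGenealogyRealise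
open Summit.QuantumFields.BalabanUV.T4Continuum.HistoryGenealogyInstantiate
open Summit.QuantumFields.BalabanUV.T4Continuum.HistoryGenealogyPedigree
open Summit.QuantumFields.BalabanUV.T4Continuum.B16HistoryIndexedRepr
open Summit.QuantumFields.BalabanUV.T4Continuum.HistoryBankingLE
open Summit.QuantumFields.BalabanUV.T4Continuum.HistoryConstants
open Summit.QuantumFields.BalabanUV.T4Continuum.HistoryBankingForestVolume
open Summit.QuantumFields.BalabanUV.T4Continuum.HistoryBankingVolumePlug
open Summit.QuantumFields.BalabanUV.T4Continuum.HistoryBankingForestPlug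
open Summit.QuantumFields.BalabanUV.T4Continuum.HistoryBankingDiscountCharge
open Summit.QuantumFields.BalabanUV.T4Continuum.HistoryBankingCreditRead
open Summit.QuantumFields.BalabanUV.T4Continuum.HistoryBankingCreditPlug
open Summit.QuantumFields.BalabanUV.T4Continuum.HistoryBankingFibreRoom
open Summit.QuantumFields.BalabanUV.T4Continuum.HistoryBankingFibreCharge
open Summit.QuantumFields.BalabanUV.T4Continuum.B16HistoryWeightPlug
open Summit.QuantumFields.BalabanUV.T4Continuum.B16HistoryWeightPlugW
open Summit.QuantumFields.BalabanUV.T4Continuum.HistoryAssemblyTerms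
open Summit.QuantumFields.BalabanUV.T4Continuum.HistoryAssemblyPedigree
open Summit.QuantumFields.BalabanUV.T4Continuum.HistoryAssemblyMult
open Summit.QuantumFields.BalabanUV.T4Continuum.HistoryAssemblyMultKey
open Summit.QuantumFields.BalabanUV.T4Continuum.HistoryPriceNodeSum
open Summit.QuantumFields.BalabanUV.T4Continuum.HistoryPriceKeys
open Summit.QuantumFields.BalabanUV.T4Continuum.HistoryRealiseCellsRunSupplyMembers
open Summit.QuantumFields.BalabanUV.T4Continuum.HistoryRealiseCellsRunSupplyWTVS
open Summit.QuantumFields.BalabanUV.T4Continuum.HistoryRealiseCellsRunSupplyKeysWTVS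

namespace Summit.QuantumFields.BalabanUV.T4Continuum.HistoryRealiseCellsRunSupplyWTVSW

noncomputable section

-- the structural `DecidableEq` instance of the concrete tag type exceeds the default synthesis size (as in the
-- twinned modules)
set_option synthInstance.maxSize 1024

/-! ## §1 The numerator reading of one term at weight `w`, the ledger a plug -/

section Term

variable {DomK : ℕ → Type*} {I : (K : ℕ) → HIndex (DomK K)} {d : ℕ} {X : ℕ → Type*}
  {𝒢 : (K : ℕ) → GoodClass (X K)} {γ δ : Type*} [DecidableEq γ] [DecidableEq δ]

/-- **THE NUMERATOR READING OF ONE (1.72) TERM AT WEIGHT `w`** (`HistoryRealiseCellsRunSupplyWTVS.weight_le_deadOf_mul_mul_nupOf`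
with the volume ledger displayed as the plug on the term's run and `2^{d+3} ↦ w`): `weight μ Rp t ⟨K,a,(h,ℓ,c)⟩ ≤
deadOf ℛ Φf W K t ⟨K,a,(h,ℓ,c)⟩ · FcM K (kmemOf …) · nupOf Φf mass W K t`. [folklore] -/
theorem weight_le_deadOf_mul_mul_nupOf_of_plug [∀ K, MeasurableSpace (X K)] (ℛ : HistReading I d) (Φf : HistFactors I d)
    (μ : (K : ℕ) → Measure (X K)) [∀ K, IsFiniteMeasure (μ K)] (Rp : (K : ℕ) → ℝ → Repr172R (𝒢 K) (I K))
    {l₀ : ℝ} {K₀ : ℕ} (hR : HistRead ℛ Φf Rp l₀ K₀) {K : ℕ} (hK : K₀ ≤ K) {t : ℝ} (ht : |t| ≤ l₀)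
    (a : (I K).Adm) {h : (I K).HZ} {l : (I K).HL} {c : (I K).HC} (hι : (h, l, c) ∈ (I K).LIdx a)
    (hN : (ℛ.runOf K a (h, l, c)).NewOK)
    (hRm : ∀ t k, (ℛ.runOf K a (h, l, c)).Rm t k ≤ (ℛ.runOf K a (h, l, c)).R t)
    (hRmS : ∀ t k, (ℛ.runOf K a (h, l, c)).Rm t (k + 1) ≤ (ℛ.runOf K a (h, l, c)).R (t + 1))
    (hRm2 : ∀ t, 2 ≤ (ℛ.runOf K a (h, l, c)).Rm t 1) (hD : (ℛ.runOf K a (h, l, c)).NewDisjoint)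
    (hL0 : 0 < ℛ.L) {C : T4PrintedShapeBanking.Consts} (w : ℝ)
    -- THE PLUG: every live component's tree volume factor booked by its tagged genealogy up to the `w`-weighted remainder
    (hplug : ∀ x ∈ (ℛ.runOf K a (h, l, c)).histV.comp K,
      Real.exp (treeVol ℛ.L (ℛ.s K) (fun v => (v : ℝ)) (ℛ.runOf K a (h, l, c)).pedMV (fun j => Real.log (Φf.Λ K j)) K
          (K, x)) ≤
        Real.exp (lifeCost (dictWT Prod.fst (ℛ.R K) C.n₁) (costT Prod.fst C K (ℛ.R K))
            ((ℛ.runOf K a (h, l, c)).pedMV.genT (K, x))) *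
          Real.exp (birthWT Prod.fst (fun n => w * Real.log (Φf.Λ K n)) ((ℛ.runOf K a (h, l, c)).pedMV.genT (K, x))))
    -- nonnegative birth ∕ renewal factors and the curly normalisation envelope
    (hB : ∀ j d' n, 0 ≤ Φf.fB K j d' n) (hRf : ∀ h, 0 ≤ Φf.fR K h) {W : ℕ → ℝ} (hW : 0 < W K)
    -- the root-cell and physical readings of the END
    (cellOf : ℕ → HIndex.Idx I → ℕ × Lab d → γ) (phys : ℕ → HIndex.Idx I → ℕ × Lab d → δ)
    -- the live price of the KEY family at weight `w`, read one-sidedly against M2-B's LIVE product of the term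
    {FcM : ℕ → Finset (γ × Gen PEv × δ) → ℝ}
    (hFcM : ∏ x ∈ (ℛ.runOf K a (h, l, c)).histV.comp K,
        Real.exp (lifeCost (dictWT Prod.fst (ℛ.R K) C.n₁) (costT Prod.fst C K (ℛ.R K))
            ((ℛ.runOf K a (h, l, c)).pedMV.genT (K, x))) *
          Real.exp (birthWT Prod.fst (fun n => w * Real.log (Φf.Λ K n))
            ((ℛ.runOf K a (h, l, c)).pedMV.genT (K, x))) *
          evProd (Φf.fB K) (Φf.fR K) ((ℛ.runOf K a (h, l, c)).pedMV.toPGen id (K, x)) ≤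
      FcM K (kmemOf ℛ.inputOf.pedV ℛ.inputOf.liveCV cellOf phys K ⟨K, a, (h, l, c)⟩)) :
    Repr172R.weight μ Rp t ⟨K, a, (h, l, c)⟩ ≤
      deadOf ℛ Φf W K t ⟨K, a, (h, l, c)⟩ *
        FcM K (kmemOf ℛ.inputOf.pedV ℛ.inputOf.liveCV cellOf phys K ⟨K, a, (h, l, c)⟩) *
        nupOf Φf (fun K => (μ K).real Set.univ) W K t := by
  have hw := weight_le_live_mul_dead_of_plug ℛ Φf μ Rp hR hK ht a hι hN hRm hRmS hRm2 hD hL0 (C := C) w hplug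
  set J := ℛ.runOf K a (h, l, c) with hJ
  set LIVE := ∏ x ∈ J.histV.comp K,
      Real.exp (lifeCost (dictWT Prod.fst J.R C.n₁) (costT Prod.fst C K J.R) (J.pedMV.genT (K, x))) *
        Real.exp (birthWT Prod.fst (fun n => w * Real.log (Φf.Λ K n)) (J.pedMV.genT (K, x))) *
        evProd (Φf.fB K) (Φf.fR K) (J.pedMV.toPGen id (K, x)) with hLIVE
  set DEAD := ∏ j ∈ Finset.range K, ∏ x ∈ J.histV.died j,
      Real.exp (treeVol J.L J.s (fun v => (v : ℝ)) J.pedMV (fun j => Real.log (Φf.Λ K j)) j (j, x)) *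
        evProd (Φf.fB K) (Φf.fR K) (J.pedMV.toPGen id (j, x)) with hDEAD
  set FC := FcM K (kmemOf ℛ.inputOf.pedV ℛ.inputOf.liveCV cellOf phys K ⟨K, a, (h, l, c)⟩) with hFC
  have hLIVE0 : 0 ≤ LIVE := Finset.prod_nonneg fun x _ =>
    mul_nonneg (mul_nonneg (Real.exp_pos _).le (Real.exp_pos _).le) (evProd_nonneg hB hRf _)
  have hDEAD0 : 0 ≤ DEAD := Finset.prod_nonneg fun j _ => Finset.prod_nonneg fun x _ =>
    mul_nonneg (Real.exp_pos _).le (evProd_nonneg hB hRf _)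
  have hLF : LIVE ≤ FC := hFcM
  -- the envelope: `wC ≤ |wC|`, re-split over `W K`
  have hmass : ∀ K, 0 ≤ (μ K).real Set.univ := fun K => measureReal_nonneg
  have hrest : Real.exp (Φf.BA K t) * (Φf.wC K t a c * Real.exp (Φf.BV K t a h l c)) * (μ K).real Set.univ ≤
      |Φf.wC K t a c| * Real.exp (Φf.BV K t a h l c) / W K * nupOf Φf (fun K => (μ K).real Set.univ) W K t :=
    rest_le_split Φf hmass hW t a h l c
  have hE : 0 ≤ |Φf.wC K t a c| * Real.exp (Φf.BV K t a h l c) / W K *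
      nupOf Φf (fun K => (μ K).real Set.univ) W K t :=
    mul_nonneg (div_nonneg (mul_nonneg (abs_nonneg _) (Real.exp_pos _).le) hW.le)
      (nupOf_nonneg Φf hmass (fun _ => hW.le) K t)
  have hdead : deadOf ℛ Φf W K t ⟨K, a, (h, l, c)⟩ =
      DEAD * (|Φf.wC K t a c| * Real.exp (Φf.BV K t a h l c)) / W K := by
    rw [deadOf, dmassOf]
  calc Repr172R.weight μ Rp t ⟨K, a, (h, l, c)⟩
      ≤ LIVE * DEAD * (Real.exp (Φf.BA K t) * (Φf.wC K t a c * Real.exp (Φf.BV K t a h l c)) *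
          (μ K).real Set.univ) := hw
    _ ≤ LIVE * DEAD * (|Φf.wC K t a c| * Real.exp (Φf.BV K t a h l c) / W K *
          nupOf Φf (fun K => (μ K).real Set.univ) W K t) := mul_le_mul_of_nonneg_left hrest (mul_nonneg hLIVE0 hDEAD0)
    _ ≤ FC * DEAD * (|Φf.wC K t a c| * Real.exp (Φf.BV K t a h l c) / W K *
          nupOf Φf (fun K => (μ K).real Set.univ) W K t) :=
        mul_le_mul_of_nonneg_right (mul_le_mul_of_nonneg_right hLF hDEAD0) hE
    _ = _ := by rw [hdead]; ring

end Term

/-! ## §2 The witness-shaped fields at a cutoff, weight `w K`, the ledger a plug -/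

section Fields

variable {DomK : ℕ → Type*} {I : (K : ℕ) → HIndex (DomK K)} {d : ℕ} {X : ℕ → Type*}
  {𝒢 : (K : ℕ) → GoodClass (X K)} {γ δ : Type*} [DecidableEq γ] [DecidableEq δ]

/-- **`upM` OF THE VS-WITNESS FROM THE READING, ANY WEIGHT, THE LEDGER A PLUG** (`HistoryRealiseCellsRunSupplyWTVS.upM_of_reading`
with the seven volume displays replaced by the per-term plug display `hplug` at weight `w` and `hFcM` at weight `w`).
[folklore] -/
theorem upM_of_reading_of_plug [∀ K, MeasurableSpace (X K)] (ℛ : HistReading I d) (Φf : HistFactors I d)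
    (μ : (K : ℕ) → Measure (X K)) [∀ K, IsFiniteMeasure (μ K)] (Rp : (K : ℕ) → ℝ → Repr172R (𝒢 K) (I K))
    {l₀ : ℝ} {K₀ : ℕ} (hR : HistRead ℛ Φf Rp l₀ K₀) {K : ℕ} (hK : K₀ ≤ K) {t : ℝ} (ht : |t| ≤ l₀)
    (hN : ∀ τ ∈ HIndex.termSet I K, (ℛ.inputOf.run K τ).NewOK)
    (hRm : ∀ τ ∈ HIndex.termSet I K, ∀ t k, (ℛ.inputOf.run K τ).Rm t k ≤ (ℛ.inputOf.run K τ).R t)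
    (hRmS : ∀ τ ∈ HIndex.termSet I K, ∀ t k, (ℛ.inputOf.run K τ).Rm t (k + 1) ≤ (ℛ.inputOf.run K τ).R (t + 1))
    (hRm2 : ∀ τ ∈ HIndex.termSet I K, ∀ t, 2 ≤ (ℛ.inputOf.run K τ).Rm t 1)
    (hD : ∀ τ ∈ HIndex.termSet I K, (ℛ.inputOf.run K τ).NewDisjoint)
    (hL0 : 0 < ℛ.L) {C : T4PrintedShapeBanking.Consts} (w : ℝ)
    (hplug : ∀ τ ∈ HIndex.termSet I K, ∀ x ∈ (ℛ.inputOf.run K τ).histV.comp K,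
      Real.exp (treeVol ℛ.L (ℛ.s K) (fun v => (v : ℝ)) (ℛ.inputOf.run K τ).pedMV (fun j => Real.log (Φf.Λ K j)) K
          (K, x)) ≤
        Real.exp (lifeCost (dictWT Prod.fst (ℛ.R K) C.n₁) (costT Prod.fst C K (ℛ.R K))
            ((ℛ.inputOf.run K τ).pedMV.genT (K, x))) *
          Real.exp (birthWT Prod.fst (fun n => w * Real.log (Φf.Λ K n)) ((ℛ.inputOf.run K τ).pedMV.genT (K, x))))
    (hB : ∀ j d' n, 0 ≤ Φf.fB K j d' n) (hRf : ∀ h, 0 ≤ Φf.fR K h) {W : ℕ → ℝ} (hW : 0 < W K)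
    (cellOf : ℕ → HIndex.Idx I → ℕ × Lab d → γ) (phys : ℕ → HIndex.Idx I → ℕ × Lab d → δ) (jstar : ℕ → ℕ)
    {FcM : ℕ → Finset (γ × Gen PEv × δ) → ℝ}
    (hFcM : ∀ τ ∈ HIndex.termSet I K, ∏ x ∈ (ℛ.inputOf.run K τ).histV.comp K,
        Real.exp (lifeCost (dictWT Prod.fst (ℛ.R K) C.n₁) (costT Prod.fst C K (ℛ.R K))
            ((ℛ.inputOf.run K τ).pedMV.genT (K, x))) *
          Real.exp (birthWT Prod.fst (fun n => w * Real.log (Φf.Λ K n))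
            ((ℛ.inputOf.run K τ).pedMV.genT (K, x))) *
          evProd (Φf.fB K) (Φf.fR K) ((ℛ.inputOf.run K τ).pedMV.toPGen id (K, x)) ≤
      FcM K (kmemOf ℛ.inputOf.pedV ℛ.inputOf.liveCV cellOf phys K τ)) :
    ∀ k ∈ badGMems (memOf ℛ.inputOf.pedV ℛ.inputOf.liveCV cellOf) jstar (HIndex.termSet I)
        (kmemOf ℛ.inputOf.pedV ℛ.inputOf.liveCV cellOf phys) K,
      ∀ τ ∈ fibre (kmemOf ℛ.inputOf.pedV ℛ.inputOf.liveCV cellOf phys) (HIndex.termSet I) K k,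
        Repr172R.weight μ Rp t τ ≤ deadOf ℛ Φf W K t τ * FcM K k * nupOf Φf (fun K => (μ K).real Set.univ) W K t := by
  intro k _ τ hτ
  obtain ⟨hτT, hkτ⟩ := mem_fibre.1 hτ
  rw [← hkτ]
  obtain ⟨⟨a, h, l, c⟩, hp, hpe⟩ := Finset.mem_map.mp hτT
  have hτe : τ = ⟨K, a, (h, l, c)⟩ := hpe.symm
  subst hτe
  -- the family's run of the term IS the run read off its history choice (`run_inputOf`, `rfl`), rewritten syntactically
  have hF := hFcM _ hτT
  have hP := hplug _ hτT
  simp only [HistReading.run_inputOf] at hF hP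
  exact weight_le_deadOf_mul_mul_nupOf_of_plug ℛ Φf μ Rp hR hK ht a (Finset.mem_sigma.mp hp).2 (hN _ hτT) (hRm _ hτT)
    (hRmS _ hτT) (hRm2 _ hτT) (hD _ hτT) hL0 w hP hB hRf hW cellOf phys hF

/-- **`upM` AT `FcM K := LIVEOf C K (ℛ.R K) (fun n => w * log (Φf.Λ K n)) (sharpT sB sR)`, THE LEDGER A PLUG**
(`HistoryRealiseCellsRunSupplyKeysWTVS.upM_of_reading'` at weight `w`; the one-sided key reading discharged by the
weight-generic `live_le_LIVEOf`, whose members' well-formedness keeps `4 ≤ L`, drop control, `R ≥ 1`, `13 ≤ n₁`). [folklore] -/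
theorem upM_of_reading'_of_plug [∀ K, MeasurableSpace (X K)] (ℛ : HistReading I d) (Φf : HistFactors I d)
    (μ : (K : ℕ) → Measure (X K)) [∀ K, IsFiniteMeasure (μ K)] (Rp : (K : ℕ) → ℝ → Repr172R (𝒢 K) (I K))
    {l₀ : ℝ} {K₀ : ℕ} (hR : HistRead ℛ Φf Rp l₀ K₀) {K : ℕ} (hK : K₀ ≤ K) {t : ℝ} (ht : |t| ≤ l₀)
    (hN : ∀ τ ∈ HIndex.termSet I K, (ℛ.inputOf.run K τ).NewOK)
    (hRm : ∀ τ ∈ HIndex.termSet I K, ∀ t k, (ℛ.inputOf.run K τ).Rm t k ≤ (ℛ.inputOf.run K τ).R t)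
    (hRmS : ∀ τ ∈ HIndex.termSet I K, ∀ t k, (ℛ.inputOf.run K τ).Rm t (k + 1) ≤ (ℛ.inputOf.run K τ).R (t + 1))
    (hRm2 : ∀ τ ∈ HIndex.termSet I K, ∀ t, 2 ≤ (ℛ.inputOf.run K τ).Rm t 1)
    (hD : ∀ τ ∈ HIndex.termSet I K, (ℛ.inputOf.run K τ).NewDisjoint)
    (hL0 : 0 < ℛ.L) (hL4 : 4 ≤ ℛ.L) (hdrop : ∀ m, DropCtl (ℛ.s K) m) (hR1 : ∀ t, 1 ≤ ℛ.R K t)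
    {C : T4PrintedShapeBanking.Consts} (hn₁ : 13 ≤ C.n₁) (w : ℝ)
    (hplug : ∀ τ ∈ HIndex.termSet I K, ∀ x ∈ (ℛ.inputOf.run K τ).histV.comp K,
      Real.exp (treeVol ℛ.L (ℛ.s K) (fun v => (v : ℝ)) (ℛ.inputOf.run K τ).pedMV (fun j => Real.log (Φf.Λ K j)) K
          (K, x)) ≤
        Real.exp (lifeCost (dictWT Prod.fst (ℛ.R K) C.n₁) (costT Prod.fst C K (ℛ.R K))
            ((ℛ.inputOf.run K τ).pedMV.genT (K, x))) *
          Real.exp (birthWT Prod.fst (fun n => w * Real.log (Φf.Λ K n)) ((ℛ.inputOf.run K τ).pedMV.genT (K, x))))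
    {sB : ℕ → ℕ → ℝ} {sR : ℕ → ℝ} (hF : FactorRead (Φf.fB K) (Φf.fR K) sB sR) {W : ℕ → ℝ} (hW : 0 < W K)
    (cellOf : ℕ → HIndex.Idx I → ℕ × Lab d → γ) (phys : ℕ → HIndex.Idx I → ℕ × Lab d → δ)
    (hinj : ∀ τ ∈ HIndex.termSet I K, Set.InjOn (cellOf K τ) (ℛ.inputOf.liveCV K τ : Set (ℕ × Lab d)))
    (jstar : ℕ → ℕ) :
    ∀ k ∈ badGMems (memOf ℛ.inputOf.pedV ℛ.inputOf.liveCV cellOf) jstar (HIndex.termSet I)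
        (kmemOf ℛ.inputOf.pedV ℛ.inputOf.liveCV cellOf phys) K,
      ∀ τ ∈ fibre (kmemOf ℛ.inputOf.pedV ℛ.inputOf.liveCV cellOf phys) (HIndex.termSet I) K k,
        Repr172R.weight μ Rp t τ ≤
          deadOf ℛ Φf W K t τ *
            LIVEOf C K (ℛ.R K) (fun n => w * Real.log (Φf.Λ K n)) (sharpT sB sR) k *
            nupOf Φf (fun K => (μ K).real Set.univ) W K t :=
  upM_of_reading_of_plug ℛ Φf μ Rp hR hK ht hN hRm hRmS hRm2 hD hL0 w hplug hF.fB_nonneg hF.fR_nonneg hW cellOf phys jstar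
    (FcM := fun K k => LIVEOf C K (ℛ.R K) (fun n => w * Real.log (Φf.Λ K n)) (sharpT sB sR) k)
    fun τ hτ => live_le_LIVEOf hF ℛ.inputOf C _ cellOf phys
      (wf_genT_pedV_inputOf ℛ (hN τ hτ) (hRm τ hτ) (hRmS τ hτ) (hRm2 τ hτ) (hD τ hτ) hL0 hL4 hdrop hR1 hn₁) (hinj τ hτ)

/-- **`priceM` OF THE VS-WITNESS FROM THE READING AT A WEIGHT FUNCTION `u`** (`HistoryRealiseCellsRunSupplyKeysWTVS.priceM_of_reading`
with `2^{d+3}·log Λ K ↦ u`; the engine `HistoryPriceKeys.priceM_of_keys_of_charge` is weight-generic):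
`LIVEOf C K (ℛ.R K) u (sharpT sB sR) (kmemOf …) * MULTOf (sharpT φB φR) (kmemOf …) ≤ ∏_{q ∈ memOf … K τ} pshapeTH … q.2 ·
e^{birthWT Prod.fst u q.2} · e^{−(8∕E₂·totalCostT … + 4·partnerAges …)}`. [folklore] -/
theorem priceM_of_reading_w (ℛ : HistReading I d) {K : ℕ}
    (hN : ∀ τ ∈ HIndex.termSet I K, (ℛ.inputOf.run K τ).NewOK)
    (hRm : ∀ τ ∈ HIndex.termSet I K, ∀ t k, (ℛ.inputOf.run K τ).Rm t k ≤ (ℛ.inputOf.run K τ).R t)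
    (hRmS : ∀ τ ∈ HIndex.termSet I K, ∀ t k, (ℛ.inputOf.run K τ).Rm t (k + 1) ≤ (ℛ.inputOf.run K τ).R (t + 1))
    (hRm2 : ∀ τ ∈ HIndex.termSet I K, ∀ t, 2 ≤ (ℛ.inputOf.run K τ).Rm t 1)
    (hD : ∀ τ ∈ HIndex.termSet I K, (ℛ.inputOf.run K τ).NewDisjoint)
    (hL0 : 0 < ℛ.L) (hL4 : 4 ≤ ℛ.L) (hdrop : ∀ m, DropCtl (ℛ.s K) m) (hR1 : ∀ t, 1 ≤ ℛ.R K t)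
    {C : T4PrintedShapeBanking.Consts} (hn₁ : 13 ≤ C.n₁) (hE₂ : 0 < C.E₂) (hE₃ : 0 ≤ C.E₃)
    {O : PrintedO1s} {g : ℕ → ℝ} {L : ℕ} {β' β₀ : ℝ} {sB φB : ℕ → ℕ → ℝ} {sR φR : ℕ → ℝ}
    (hRR : RoundingRoomF C O L K (ℛ.R K) g sB sR φB φR) (h29 : B14FlowStep.FlowIneq29 (ℛ.R K) g L β' β₀ K)
    (hL1 : 1 ≤ L) (u : ℕ → ℝ)
    (cellOf : ℕ → HIndex.Idx I → ℕ × Lab d → γ) (phys : ℕ → HIndex.Idx I → ℕ × Lab d → δ)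
    (hinj : ∀ τ ∈ HIndex.termSet I K, Set.InjOn (cellOf K τ) (ℛ.inputOf.liveCV K τ : Set (ℕ × Lab d)))
    (jstar : ℕ → ℕ) :
    ∀ τ ∈ badTerms (memOf ℛ.inputOf.pedV ℛ.inputOf.liveCV cellOf) jstar (HIndex.termSet I) K,
      LIVEOf C K (ℛ.R K) u (sharpT sB sR) (kmemOf ℛ.inputOf.pedV ℛ.inputOf.liveCV cellOf phys K τ) *
          MULTOf (sharpT φB φR) (kmemOf ℛ.inputOf.pedV ℛ.inputOf.liveCV cellOf phys K τ) ≤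
        ∏ q ∈ memOf ℛ.inputOf.pedV ℛ.inputOf.liveCV cellOf K τ,
          pshapeTH Prod.fst O C 1 1 (ℛ.R K) g 0 (costT Prod.fst C K (ℛ.R K)) q.2 *
            Real.exp (birthWT Prod.fst u q.2) *
            Real.exp (-(8 / C.E₂ * totalCostT Prod.fst C K (ℛ.R K) q.2 +
              4 * (partnerAges (PEv.step ∘ Prod.fst) q.2 : ℝ))) := by
  intro τ hτ
  have hτT : τ ∈ HIndex.termSet I K := (mem_badTerms.1 hτ).1
  have hWF := wf_genT_pedV_inputOf ℛ (C := C) (hN τ hτT) (hRm τ hτT) (hRmS τ hτT) (hRm2 τ hτT) (hD τ hτT) hL0 hL4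
    hdrop hR1 hn₁
  have hCT := consistentTLE_genT_pedV_inputOf ℛ C (hN τ hτT) (hRm τ hτT) (hRmS τ hτT) (hRm2 τ hτT) (hD τ hτT) hL0
    hL4 hdrop hR1 hn₁
  exact priceM_of_keys_of_charge (hinj τ hτT) hWF fun c hc =>
    credits_add_discount_add_fshare_le_sharps h29 hL1 hE₂ hE₃ hRR (hWF c hc) (hCT c hc)

end Fields

/-! ## §3 The key family's `LIVEOf` is monotone in the class weight -/

section Mono

variable {γ δ : Type*}

/-- the birth-weight letter is monotone in the weight function [folklore] -/
theorem bwLetter_mono {ε : Type*} (sh : ε → PEv) {u u' : ℕ → ℝ} (hu : ∀ n, u n ≤ u' n) (e : ε) :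
    bwLetter sh u e ≤ bwLetter sh u' e := by
  unfold bwLetter
  split_ifs
  · exact mul_le_mul_of_nonneg_right (hu _) (by positivity)
  · exact le_rfl

/-- the flat sharp live factor of a key letter is monotone in the weight function [folklore] -/
theorem liveSharpN_mono (C : T4PrintedShapeBanking.Consts) (K : ℕ) (R : ℕ → ℕ) {u u' : ℕ → ℝ} (hu : ∀ n, u n ≤ u' n)
    (σ : PEv → ℝ) (G : Gen PEv) : liveSharpN C K R u σ G ≤ liveSharpN C K R u' σ G := by
  unfold liveSharpN birthWN
  exact mul_le_mul_of_nonneg_right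
    (mul_le_mul_of_nonneg_left (Real.exp_le_exp.2 (nsum_le_nsum (fun e => bwLetter_mono id hu e) G)) (Real.exp_pos _).le)
    (Real.exp_pos _).le

/-- **THE KEY FAMILY's `LIVEOf` IS MONOTONE IN THE CLASS WEIGHT**: `u ≤ u′` pointwise ⇒ `LIVEOf C K R u σ k ≤ LIVEOf C K R u′ σ k`
— so a run-B display `upB` booked at weight `2^{d+3}` (the records' field) serves every heavier weight (`cvol`, `cvol82`).
[folklore] -/
theorem LIVEOf_mono_weight (C : T4PrintedShapeBanking.Consts) (K : ℕ) (R : ℕ → ℕ) {u u' : ℕ → ℝ} (hu : ∀ n, u n ≤ u' n)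
    (σ : PEv → ℝ) (k : Finset (γ × Gen PEv × δ)) : LIVEOf C K R u σ k ≤ LIVEOf C K R u' σ k := by
  unfold LIVEOf
  exact Finset.prod_le_prod (fun w _ => (liveSharpN_pos C K R u σ w.2.1).le) fun w _ => liveSharpN_mono C K R hu σ w.2.1

/-- the same for a weight CONSTANT on nonnegative costs: `w ≤ w′`, `0 ≤ v n` ⇒ `LIVEOf … (w·v) … ≤ LIVEOf … (w′·v) …`. [folklore] -/
theorem LIVEOf_mono_const (C : T4PrintedShapeBanking.Consts) (K : ℕ) (R : ℕ → ℕ) {w w' : ℝ} (hw : w ≤ w') {v : ℕ → ℝ}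
    (hv : ∀ n, 0 ≤ v n) (σ : PEv → ℝ) (k : Finset (γ × Gen PEv × δ)) :
    LIVEOf C K R (fun n => w * v n) σ k ≤ LIVEOf C K R (fun n => w' * v n) σ k :=
  LIVEOf_mono_weight C K R (fun n => mul_le_mul_of_nonneg_right hw (hv n)) σ k

end Mono

end

end Summit.QuantumFields.BalabanUV.T4Continuum.HistoryRealiseCellsRunSupplyWTVSW
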